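import Summits.AtomisticToContinuum.BoseEinsteinCondensation.Theses.BECRieszReverseHolder
import Summits.AtomisticToContinuum.BoseEinsteinCondensation.Theorems.BECCutLineWeakDisorderFlatModeFromLandscape
import Summits.AtomisticToContinuum.BoseEinsteinCondensation.Theorems.BECRieszReverseHolderTwoScaleGlueHolder
import Literature.MathematicalPhysics.QuantumManyBody.BoseGasFreeDirichletBEC

/-!
# Route `BECRieszReverseHolder` — support item `TwoScaleGlue` (stmt-AtomisticToContinuum-12843)

The route decl `TwoScaleGlue := CoarseGrainedReverseHolder → MicroscaleFlatness → PositiveZeroMode`,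
proved as stated (`twoScaleGlue_proof`).

Notation for a nonnegative admissible state `Ψ ∈ TrialState (n+1) L`, `L = ((n+1)/ρ)^{1/3}`, and a
bath configuration `X̂ ∈ (ℝ³)ⁿ`: `s(X̂) = ∫ |Ψ(y, X̂)| dy`, `M(X̂) = ∫ |Ψ(y, X̂)|² dy`, and for the
`m³` congruent cubes `Q_k = ∏ᵢ [kᵢ a, (kᵢ+1) a)`, `a = L/m`, `m = ⌊L/ℓ⌋` (these are the sub-cells
`BoseGas.subCell a k`, `cube_eq_subCell`): `w_k = ∫_{Q_k} |Ψ(·, X̂)|²`, `s_k = ∫_{Q_k} |Ψ(·, X̂)|`,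
`B = ∑_{bad} w_k` over the bad cubes `s_k² < c₀ a³ w_k`.

Proof.
* Flat-mode occupation of a nonnegative state is the slice functional
  `⟨φ₀, γ_Ψ φ₀⟩ = (n+1) ∫ L⁻³ s(X̂)² dX̂` (`occupation_flatMode_eq`, from
  `FlatModeFromLandscape.enorm_integral_conj_flatMode_mul_slice`).
* Pointwise in `X̂` (`slice_pointwise`): the cubes tile `[0, L)³ ⊇ Λ_L` so `∑ w_k = M`
  (`sum_cubeMass_eq`) and `∑ s_k ≤ s` (`sum_cubeL1_le`); with `c₀ a³ w_k ≤ s_k²` on good cubes the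
  finite three-factor Hölder (`key_finite`) gives `c₀ a³ (M − B)³ ≤ s² · ∑ w_k²`.
* In `dX̂` (`main_estimate`): dividing by `L³ = m³ a³` and writing
  `s² ∑w² / L³ = (L⁻³ s²) · (∑ w²/M) · M` (`M < ∞` a.e. since `∫ M = 1`), the three-factor Hölder in
  cube form (`mul_lintegral_pow_three_le`) yields
  `c₀ (∫ (M − B))³ ≤ (∫ L⁻³ s²) · (m³ ∫ ∑w²/M) · ∫ M ≤ (∫ L⁻³ s²) · C · 1`,
  while `∫ (M − B) ≥ ∫ M − ∫ B ≥ 1 − θ`; hence `⟨φ₀, γ_Ψ φ₀⟩ ≥ c₀ (1−θ)³/C · (n+1)`.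
* `twoScaleGlue_proof`: `ρ₀ = min` of the two thresholds, `θ ↦ max θ 0`, `C ↦ max C 1`,
  `c = c₀ (1 − θ)³ / C`, `δ = min δ₁ δ₂` for `n` in both eventual ranges and with `ℓ ≤ L`
  (`L → ∞`, so `m ≥ 1`), then the shift `n + 1 ↦ N`.

Elementary (Hölder + Tonelli); no named facts, unconditional. Sources of the item: LSSY2005 §1.2
(1.17) for the occupation; Stein1993 for the reverse-Hölder vocabulary (not used formally).
-/

noncomputable section

open MeasureTheory Set Filter
open scoped ENNReal NNReal ComplexConjugate

namespace Summit.AtomisticToContinuum.BoseEinsteinCondensation.Theorems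

open Literature.MathematicalPhysics.QuantumManyBody.BoseGas

namespace TwoScaleGlueProof

/-! ### The cube partition of the slice -/

variable {n : ℕ} {L : ℝ}

/-- The route's congruent cubes `∏ᵢ [kᵢ a, (kᵢ + 1) a)` are the sub-cells `subCell a k` of
`BoseGasFreeDirichletBEC`. [folklore] -/
theorem cube_eq_subCell {m : ℕ} (a : ℝ) (k : Fin 3 → Fin m) :
    {y : EuclideanSpace ℝ (Fin 3) | ∀ i, y i ∈ Set.Ico ((k i : ℝ) * a) (((k i : ℝ) + 1) * a)} =
      subCell a k := by
  ext y
  simp only [Set.mem_setOf_eq, Set.mem_Ico, mem_subCell]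
  refine forall_congr' fun i => ?_
  have h1 : ((k i : ℕ) : ℝ) * a = a * ((k i : ℕ) : ℝ) := mul_comm _ _
  have h2 : (((k i : ℕ) : ℝ) + 1) * a = a * ((k i : ℕ) : ℝ) + a := by ring
  rw [h1, h2]

/-- The slice modulus `(y, X̂) ↦ |Ψ(y, X̂)|` is jointly measurable. [folklore] -/
theorem measurable_sliceModulus (Ψ : TrialState (n + 1) L) :
    Measurable fun p : Space × Config n => (‖Ψ.ψ (Matrix.vecCons p.1 p.2)‖₊ : ℝ≥0∞) :=
  (Ψ.contDiff.continuous.measurable.comp measurable_vecCons).nnnorm.coe_nnreal_ennreal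

/-- For one slice: `y ↦ |Ψ(y, X̂)|` is measurable. [folklore] -/
theorem measurable_sliceModulus_left (Ψ : TrialState (n + 1) L) (X : Config n) :
    Measurable fun y : Space => (‖Ψ.ψ (Matrix.vecCons y X)‖₊ : ℝ≥0∞) :=
  (measurable_comp_vecCons_left Ψ.contDiff.continuous.measurable X).nnnorm.coe_nnreal_ennreal

/-- `X̂ ↦ s(X̂) = ∫ |Ψ(y, X̂)| dy` is measurable. [folklore] -/
theorem measurable_sliceL1 (Ψ : TrialState (n + 1) L) :
    Measurable fun X : Config n => ∫⁻ y, (‖Ψ.ψ (Matrix.vecCons y X)‖₊ : ℝ≥0∞) :=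
  (measurable_sliceModulus Ψ).lintegral_prod_left'

/-- `X̂ ↦ M(X̂) = ∫ |Ψ(y, X̂)|² dy` is measurable. [folklore] -/
theorem measurable_sliceMass (Ψ : TrialState (n + 1) L) :
    Measurable fun X : Config n => ∫⁻ y, (‖Ψ.ψ (Matrix.vecCons y X)‖₊ : ℝ≥0∞) ^ 2 :=
  ((measurable_sliceModulus Ψ).pow_const 2).lintegral_prod_left'

/-- `X̂ ↦ s_Q(X̂) = ∫_Q |Ψ(y, X̂)| dy` is measurable. [folklore] -/
theorem measurable_cubeL1 (Ψ : TrialState (n + 1) L) (Q : Set Space) :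
    Measurable fun X : Config n => ∫⁻ y in Q, (‖Ψ.ψ (Matrix.vecCons y X)‖₊ : ℝ≥0∞) :=
  (measurable_sliceModulus Ψ).lintegral_prod_left' (μ := volume.restrict Q)

/-- `X̂ ↦ w_Q(X̂) = ∫_Q |Ψ(y, X̂)|² dy` is measurable. [folklore] -/
theorem measurable_cubeMass (Ψ : TrialState (n + 1) L) (Q : Set Space) :
    Measurable fun X : Config n => ∫⁻ y in Q, (‖Ψ.ψ (Matrix.vecCons y X)‖₊ : ℝ≥0∞) ^ 2 :=
  ((measurable_sliceModulus Ψ).pow_const 2).lintegral_prod_left' (μ := volume.restrict Q)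

/-- The cube `L¹`-masses of a slice add up to at most its total `L¹`-mass (disjoint cubes).
[folklore] -/
theorem sum_cubeL1_le {m : ℕ} {a : ℝ} (ha : 0 < a) (Ψ : TrialState (n + 1) L) (X : Config n) :
    ∑ k : Fin 3 → Fin m, ∫⁻ y in subCell a k, (‖Ψ.ψ (Matrix.vecCons y X)‖₊ : ℝ≥0∞) ≤
      ∫⁻ y, (‖Ψ.ψ (Matrix.vecCons y X)‖₊ : ℝ≥0∞) :=
  sum_setLIntegral_subCell_le ha (measurable_sliceModulus_left Ψ X).aemeasurable

/-- The cube masses of a slice add up to the slice mass: the `m³` cubes of side `a = L/m` tile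
`[0, L)³ ⊇ Λ_L`, off which the slice vanishes (Dirichlet condition). [folklore] -/
theorem sum_cubeMass_eq {m : ℕ} {a : ℝ} (ha : 0 < a) (hma : (m : ℝ) * a = L)
    (Ψ : TrialState (n + 1) L) (X : Config n) :
    ∑ k : Fin 3 → Fin m, ∫⁻ y in subCell a k, (‖Ψ.ψ (Matrix.vecCons y X)‖₊ : ℝ≥0∞) ^ 2 =
      ∫⁻ y, (‖Ψ.ψ (Matrix.vecCons y X)‖₊ : ℝ≥0∞) ^ 2 := by
  rw [sum_setLIntegral_subCell ha ((measurable_sliceModulus_left Ψ X).pow_const 2).aemeasurable,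
    hma, ← lintegral_indicator (measurableSet_cell L)]
  refine lintegral_congr fun y => ?_
  by_cases hy : y ∈ cell L
  · rw [Set.indicator_of_mem hy]
  · rw [Set.indicator_of_notMem hy, FlatModeFromLandscape.slice_eq_zero Ψ X
      (fun hb => hy fun i => Set.Ioo_subset_Ico_self (hb i))]
    simp

/-- **The pointwise two-scale inequality on one slice.** With `M = ∫|Ψ(·,X̂)|²`, `s = ∫|Ψ(·,X̂)|`,
cube masses `w_k`, `s_k` at side `a = L/m`, and `B` the mass of the bad cubes
(`s_k² < c·w_k`): `c (M − B)³ ≤ s² · ∑_k w_k²`. [folklore] -/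
theorem slice_pointwise {m : ℕ} {a : ℝ} (ha : 0 < a) (hma : (m : ℝ) * a = L) (c : ℝ)
    (Ψ : TrialState (n + 1) L) (X : Config n) :
    ENNReal.ofReal c *
      ((∫⁻ y, (‖Ψ.ψ (Matrix.vecCons y X)‖₊ : ℝ≥0∞) ^ 2) -
        ∑ k : Fin 3 → Fin m,
          if (∫⁻ y in subCell a k, (‖Ψ.ψ (Matrix.vecCons y X)‖₊ : ℝ≥0∞)) ^ 2 <
              ENNReal.ofReal c * ∫⁻ y in subCell a k, (‖Ψ.ψ (Matrix.vecCons y X)‖₊ : ℝ≥0∞) ^ 2 then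
            ∫⁻ y in subCell a k, (‖Ψ.ψ (Matrix.vecCons y X)‖₊ : ℝ≥0∞) ^ 2 else 0) ^ 3 ≤
      (∫⁻ y, (‖Ψ.ψ (Matrix.vecCons y X)‖₊ : ℝ≥0∞)) ^ 2 *
        ∑ k : Fin 3 → Fin m, (∫⁻ y in subCell a k, (‖Ψ.ψ (Matrix.vecCons y X)‖₊ : ℝ≥0∞) ^ 2) ^ 2 := by
  have key := key_finite (ι := Fin 3 → Fin m) (c := ENNReal.ofReal c) ENNReal.ofReal_ne_top
    (fun k => ∫⁻ y in subCell a k, (‖Ψ.ψ (Matrix.vecCons y X)‖₊ : ℝ≥0∞) ^ 2)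
    (fun k => ∫⁻ y in subCell a k, (‖Ψ.ψ (Matrix.vecCons y X)‖₊ : ℝ≥0∞))
  rw [sum_cubeMass_eq ha hma Ψ X] at key
  refine key.trans ?_
  gcongr
  exact sum_cubeL1_le ha Ψ X

/-- **The flat-mode occupation of a nonnegative state is the slice functional**
`⟨φ₀, γ_Ψ φ₀⟩ = (n+1) ∫ L⁻³ s(X̂)² dX̂`, `s(X̂) = ∫ |Ψ(y, X̂)| dy`. [folklore] -/
theorem occupation_flatMode_eq (hL : 0 < L) (Ψ : TrialState (n + 1) L)
    (hpos : ∀ X, Ψ.ψ X = (‖Ψ.ψ X‖ : ℂ)) :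
    occupation (n + 1) ((box L).indicator fun _ => ((Real.sqrt (L ^ 3))⁻¹ : ℂ)) Ψ.ψ =
      (n + 1 : ℝ≥0∞) * ∫⁻ X : Config n,
        (ENNReal.ofReal (L ^ 3))⁻¹ * (∫⁻ y, (‖Ψ.ψ (Matrix.vecCons y X)‖₊ : ℝ≥0∞)) ^ 2 := by
  show (n + 1 : ℝ≥0∞) * ∫⁻ Y : Config n, (‖∫ x, conj (((box L).indicator fun _ =>
      ((Real.sqrt (L ^ 3))⁻¹ : ℂ)) x) * Ψ.ψ (Matrix.vecCons x Y)‖₊ : ℝ≥0∞) ^ 2 = _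
  congr 1
  refine lintegral_congr fun X => ?_
  rw [FlatModeFromLandscape.enorm_integral_conj_flatMode_mul_slice hL Ψ hpos X, mul_pow,
    ← ENNReal.inv_pow, ← ENNReal.ofReal_pow (Real.sqrt_nonneg _), Real.sq_sqrt (by positivity)]

/-- **The glue at fixed `N = n + 1`.** From the coarse-grained reverse-Hölder bound (constant `C`)
and the microscale-flatness bound (bad mass `≤ θ < 1`, threshold `c₀`) at one common resolution
`a = L/m`, every nonnegative state has flat-mode occupation `≥ c₀ (1 − θ)³ / C · (n + 1)`:
pointwise `c₀ a³ (M − B)³ ≤ s² ∑ w²` (`slice_pointwise`), then the three-factor Hölder in `dX̂`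
with the factors `L⁻³ s²`, `∑ w² / M`, `M` and `∫ M = 1`, `∫ B ≤ θ`. [folklore] -/
theorem main_estimate {m : ℕ} {c₀ θ C : ℝ} (hL : 0 < L) (hm : 0 < m) (hc₀ : 0 ≤ c₀)
    (hθ0 : 0 ≤ θ) (hθ1 : θ < 1) (hC : 0 < C) (Ψ : TrialState (n + 1) L)
    (hpos : ∀ X, Ψ.ψ X = (‖Ψ.ψ X‖ : ℂ))
    (h1 : (m : ℝ≥0∞) ^ 3 * ∫⁻ X : Config n,
      (∑ k : Fin 3 → Fin m,
          (∫⁻ y in subCell (L / m) k, (‖Ψ.ψ (Matrix.vecCons y X)‖₊ : ℝ≥0∞) ^ 2) ^ 2) /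
        (∫⁻ y, (‖Ψ.ψ (Matrix.vecCons y X)‖₊ : ℝ≥0∞) ^ 2) ≤ ENNReal.ofReal C)
    (h2 : ∫⁻ X : Config n, (∑ k : Fin 3 → Fin m,
      if (∫⁻ y in subCell (L / m) k, (‖Ψ.ψ (Matrix.vecCons y X)‖₊ : ℝ≥0∞)) ^ 2 <
          ENNReal.ofReal (c₀ * (L / m) ^ 3) *
            ∫⁻ y in subCell (L / m) k, (‖Ψ.ψ (Matrix.vecCons y X)‖₊ : ℝ≥0∞) ^ 2 then
        ∫⁻ y in subCell (L / m) k, (‖Ψ.ψ (Matrix.vecCons y X)‖₊ : ℝ≥0∞) ^ 2 else 0) ≤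
      ENNReal.ofReal θ) :
    ENNReal.ofReal (c₀ * (1 - θ) ^ 3 / C * ((n + 1 : ℕ) : ℝ)) ≤
      occupation (n + 1) ((box L).indicator fun _ => ((Real.sqrt (L ^ 3))⁻¹ : ℂ)) Ψ.ψ := by
  -- the common resolution `a = L / m`
  have hm0 : (m : ℝ) ≠ 0 := by exact_mod_cast hm.ne'
  have ha : 0 < L / m := div_pos hL (by exact_mod_cast hm)
  have hma : (m : ℝ) * (L / m) = L := by field_simp
  have hL3 : 0 < L ^ 3 := by positivity
  -- names for the slice functionals
  set S : Config n → ℝ≥0∞ := fun X => ∫⁻ y, (‖Ψ.ψ (Matrix.vecCons y X)‖₊ : ℝ≥0∞)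
  set M : Config n → ℝ≥0∞ := fun X => ∫⁻ y, (‖Ψ.ψ (Matrix.vecCons y X)‖₊ : ℝ≥0∞) ^ 2 with hMdef
  set w : (Fin 3 → Fin m) → Config n → ℝ≥0∞ := fun k X =>
    ∫⁻ y in subCell (L / m) k, (‖Ψ.ψ (Matrix.vecCons y X)‖₊ : ℝ≥0∞) ^ 2
  set s : (Fin 3 → Fin m) → Config n → ℝ≥0∞ := fun k X =>
    ∫⁻ y in subCell (L / m) k, (‖Ψ.ψ (Matrix.vecCons y X)‖₊ : ℝ≥0∞)
  set S₂ : Config n → ℝ≥0∞ := fun X => ∑ k, w k X ^ 2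
  set B : Config n → ℝ≥0∞ := fun X => ∑ k,
    if s k X ^ 2 < ENNReal.ofReal (c₀ * (L / m) ^ 3) * w k X then w k X else 0
  -- the hypotheses in these terms
  have h1' : (m : ℝ≥0∞) ^ 3 * ∫⁻ X, S₂ X / M X ≤ ENNReal.ofReal C := h1
  have h2' : ∫⁻ X, B X ≤ ENNReal.ofReal θ := h2
  -- measurability
  have hSm : Measurable S := measurable_sliceL1 Ψ
  have hMm : Measurable M := measurable_sliceMass Ψ
  have hwm : ∀ k, Measurable (w k) := fun k => measurable_cubeMass Ψ _
  have hsm : ∀ k, Measurable (s k) := fun k => measurable_cubeL1 Ψ _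
  have hS₂m : Measurable S₂ := Finset.measurable_sum _ fun k _ => (hwm k).pow_const 2
  have hBm : Measurable B := by
    refine Finset.measurable_sum _ fun k _ => Measurable.ite ?_ (hwm k) measurable_const
    exact measurableSet_lt ((hsm k).pow_const 2) ((hwm k).const_mul _)
  -- normalisation `∫ M = 1`, hence `M < ⊤` a.e.
  have hnorm : ∫⁻ X, M X = 1 := by
    rw [hMdef, lintegral_lintegral_sq_nnnorm_vecCons Ψ.contDiff.continuous.measurable]
    exact Ψ.norm_eq
  have hMfin : ∀ᵐ X, M X < ⊤ := ae_lt_top hMm (by rw [hnorm]; exact ENNReal.one_ne_top)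
  -- the occupation in slice form
  have hocc := occupation_flatMode_eq hL Ψ hpos
  -- three-factor Hölder in `dX̂`
  set c : ℝ≥0∞ := (ENNReal.ofReal (L ^ 3))⁻¹ * ENNReal.ofReal (c₀ * (L / m) ^ 3) with hcdef
  have hL3ne0 : ENNReal.ofReal (L ^ 3) ≠ 0 := by
    rwa [Ne, ENNReal.ofReal_eq_zero, not_le]
  have hctop : c ≠ ⊤ := ENNReal.mul_ne_top (ENNReal.inv_ne_top.2 hL3ne0) ENNReal.ofReal_ne_top
  have hHolder : c * (∫⁻ X, (M X - B X)) ^ 3 ≤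
      (∫⁻ X, (ENNReal.ofReal (L ^ 3))⁻¹ * S X ^ 2) * (∫⁻ X, S₂ X / M X) * ∫⁻ X, M X := by
    refine mul_lintegral_pow_three_le hctop ((hSm.pow_const 2).const_mul _).aemeasurable
      (hS₂m.div hMm).aemeasurable hMm.aemeasurable ?_
    filter_upwards [hMfin] with X hX
    have hpt : ENNReal.ofReal (c₀ * (L / m) ^ 3) * (M X - B X) ^ 3 ≤ S X ^ 2 * S₂ X :=
      slice_pointwise ha hma _ Ψ X
    by_cases hM0 : M X = 0
    · have hB0 : M X - B X = 0 := by rw [hM0]; exact zero_tsub _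
      rw [hB0]
      simp
    · calc c * (M X - B X) ^ 3
          = (ENNReal.ofReal (L ^ 3))⁻¹ * (ENNReal.ofReal (c₀ * (L / m) ^ 3) * (M X - B X) ^ 3) := by
            rw [hcdef, mul_assoc]
        _ ≤ (ENNReal.ofReal (L ^ 3))⁻¹ * (S X ^ 2 * S₂ X) := by gcongr
        _ = (ENNReal.ofReal (L ^ 3))⁻¹ * S X ^ 2 * (S₂ X / M X * M X) := by
            rw [ENNReal.div_mul_cancel hM0 hX.ne, mul_assoc]
        _ = (ENNReal.ofReal (L ^ 3))⁻¹ * S X ^ 2 * (S₂ X / M X) * M X := by ring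
  -- the constant: `m³ · c = c₀`
  have hmc : (m : ℝ≥0∞) ^ 3 * c = ENNReal.ofReal c₀ := by
    have hm3 : (m : ℝ≥0∞) ^ 3 = ENNReal.ofReal ((m : ℝ) ^ 3) := by
      rw [ENNReal.ofReal_pow (Nat.cast_nonneg _), ENNReal.ofReal_natCast]
    rw [hcdef, hm3, ENNReal.ofReal_mul hc₀, div_pow, mul_comm (ENNReal.ofReal (L ^ 3))⁻¹,
      ← mul_assoc, ← mul_assoc, mul_comm (ENNReal.ofReal ((m : ℝ) ^ 3)), mul_assoc (ENNReal.ofReal c₀),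
      ← ENNReal.ofReal_mul (by positivity), mul_div_cancel₀ _ (by positivity : (m : ℝ) ^ 3 ≠ 0),
      mul_assoc, ENNReal.mul_inv_cancel hL3ne0 ENNReal.ofReal_ne_top, mul_one]
  -- lower bound on the good mass: `1 - θ ≤ ∫ (M - B)`
  have hgood : ENNReal.ofReal (1 - θ) ≤ ∫⁻ X, (M X - B X) := by
    calc ENNReal.ofReal (1 - θ) = 1 - ENNReal.ofReal θ := by
          rw [ENNReal.ofReal_sub _ hθ0, ENNReal.ofReal_one]
      _ ≤ (∫⁻ X, M X) - ∫⁻ X, B X := by rw [hnorm]; exact tsub_le_tsub_left h2' _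
      _ ≤ ∫⁻ X, (M X - B X) := lintegral_sub_le' _ _ hBm.aemeasurable
  -- assemble: `c₀ (1 - θ)³ ≤ I · C`
  have hmain : ENNReal.ofReal (c₀ * (1 - θ) ^ 3) ≤
      (∫⁻ X, (ENNReal.ofReal (L ^ 3))⁻¹ * S X ^ 2) * ENNReal.ofReal C := by
    calc ENNReal.ofReal (c₀ * (1 - θ) ^ 3)
        = (m : ℝ≥0∞) ^ 3 * c * ENNReal.ofReal (1 - θ) ^ 3 := by
          rw [hmc, ENNReal.ofReal_mul hc₀, ENNReal.ofReal_pow (by linarith)]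
      _ ≤ (m : ℝ≥0∞) ^ 3 * c * (∫⁻ X, (M X - B X)) ^ 3 := by gcongr
      _ = (m : ℝ≥0∞) ^ 3 * (c * (∫⁻ X, (M X - B X)) ^ 3) := by rw [mul_assoc]
      _ ≤ (m : ℝ≥0∞) ^ 3 * ((∫⁻ X, (ENNReal.ofReal (L ^ 3))⁻¹ * S X ^ 2) *
            (∫⁻ X, S₂ X / M X) * ∫⁻ X, M X) := by gcongr
      _ = (∫⁻ X, (ENNReal.ofReal (L ^ 3))⁻¹ * S X ^ 2) *
            ((m : ℝ≥0∞) ^ 3 * ∫⁻ X, S₂ X / M X) := by rw [hnorm]; ring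
      _ ≤ (∫⁻ X, (ENNReal.ofReal (L ^ 3))⁻¹ * S X ^ 2) * ENNReal.ofReal C := by gcongr
  -- divide by `C` and multiply by `n + 1`
  have hCne0 : ENNReal.ofReal C ≠ 0 := by rwa [Ne, ENNReal.ofReal_eq_zero, not_le]
  have hI : ENNReal.ofReal (c₀ * (1 - θ) ^ 3 / C) ≤ ∫⁻ X, (ENNReal.ofReal (L ^ 3))⁻¹ * S X ^ 2 := by
    rw [← ENNReal.mul_le_mul_iff_left hCne0 ENNReal.ofReal_ne_top,
      ← ENNReal.ofReal_mul (by positivity), div_mul_cancel₀ _ hC.ne']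
    exact hmain
  rw [hocc, ENNReal.ofReal_mul (by positivity), ENNReal.ofReal_natCast, mul_comm]
  have hcast : ((n + 1 : ℕ) : ℝ≥0∞) = (n + 1 : ℝ≥0∞) := by push_cast; ring
  rw [hcast]
  exact mul_le_mul' le_rfl hI

end TwoScaleGlueProof

open TwoScaleGlueProof in
/-- **`TwoScaleGlue` (stmt-AtomisticToContinuum-12843), as stated in the route file:**
`CoarseGrainedReverseHolder → MicroscaleFlatness → PositiveZeroMode`. Take `ρ₀` the minimum of
the two thresholds; for `ρ < ρ₀` the resolution `ℓ`, threshold `c₀` and bad-mass bound `θ < 1` of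
`MicroscaleFlatness`, the constant `C` of `CoarseGrainedReverseHolder` at that `ℓ`, and
`c = c₀ (1 − θ⁺)³ / max(C, 1)`; for `n` in both eventual ranges and with `ℓ ≤ L` (`L → ∞`), take
`δ = min(δ₁, δ₂)` and apply `main_estimate`; finally shift `n + 1 ↦ N`. [folklore] -/
theorem twoScaleGlue_proof :
    Summit.AtomisticToContinuum.BoseEinsteinCondensation.Theses.BECRieszReverseHolder.TwoScaleGlue := by
  intro hCG hMF v hv
  obtain ⟨ρ₁, hρ₁, H1⟩ := hCG v hv
  obtain ⟨ρ₂, hρ₂, H2⟩ := hMF v hv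
  refine ⟨min ρ₁ ρ₂, lt_min hρ₁ hρ₂, fun ρ hρ hρlt => ?_⟩
  obtain ⟨ℓ, c₀, θ, hℓ, hc₀, hθ, hMFev⟩ := H2 ρ hρ (hρlt.trans_le (min_le_right _ _))
  obtain ⟨C, hCGev⟩ := H1 ρ hρ (hρlt.trans_le (min_le_left _ _)) ℓ hℓ
  -- harmless normalisations of the constants: `0 ≤ θ' < 1`, `1 ≤ C'`
  set θ' : ℝ := max θ 0
  set C' : ℝ := max C 1
  have hθ'1 : θ' < 1 := max_lt hθ one_pos
  have hθ'0 : 0 ≤ θ' := le_max_right _ _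
  have hC'1 : 1 ≤ C' := le_max_right _ _
  have hC'0 : 0 < C' := one_pos.trans_le hC'1
  have h1θ : 0 < 1 - θ' := sub_pos.2 hθ'1
  refine ⟨c₀ * (1 - θ') ^ 3 / C', by positivity, ?_⟩
  -- `ℓ ≤ L` eventually (`L = ((n+1)/ρ)^{1/3} → ∞`)
  have hLev : ∀ᶠ n : ℕ in atTop, ℓ ≤ sideLength ρ (n + 1) := by
    have ht : Tendsto (fun n : ℕ => sideLength ρ (n + 1)) atTop atTop :=
      (tendsto_rpow_atTop (by norm_num : (0 : ℝ) < 1 / 3)).comp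
        ((tendsto_natCast_atTop_atTop.comp (tendsto_add_atTop_nat 1)).atTop_div_const hρ)
    exact ht.eventually_ge_atTop ℓ
  -- the statement at `N = n + 1`
  have hev : ∀ᶠ n : ℕ in atTop, ∃ δ : ℝ≥0∞, 0 < δ ∧
      ∀ Ψ : TrialState (n + 1) (sideLength ρ (n + 1)),
        energy v Ψ ≤ groundStateEnergy v (n + 1) (sideLength ρ (n + 1)) + δ →
        (∀ X, Ψ.ψ X = (‖Ψ.ψ X‖ : ℂ)) →
        ENNReal.ofReal (c₀ * (1 - θ') ^ 3 / C' * ((n + 1 : ℕ) : ℝ)) ≤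
          occupation (n + 1) ((box (sideLength ρ (n + 1))).indicator fun _ =>
            ((Real.sqrt (sideLength ρ (n + 1) ^ 3))⁻¹ : ℂ)) Ψ.ψ := by
    filter_upwards [hCGev, hMFev, hLev] with n hCGn hMFn hLn
    obtain ⟨δ₁, hδ₁, hΨ₁⟩ := hCGn
    obtain ⟨δ₂, hδ₂, hΨ₂⟩ := hMFn
    refine ⟨min δ₁ δ₂, lt_min hδ₁ hδ₂, fun Ψ hE hpos => ?_⟩
    have h1 := hΨ₁ Ψ (hE.trans (add_le_add le_rfl (min_le_left _ _))) hpos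
    have h2 := hΨ₂ Ψ (hE.trans (add_le_add le_rfl (min_le_right _ _))) hpos
    dsimp only at h1 h2
    simp only [cube_eq_subCell] at h1 h2
    have hL : 0 < sideLength ρ (n + 1) := sideLength_pos_of_pos hρ (Nat.succ_pos n)
    have hm : 0 < ⌊sideLength ρ (n + 1) / ℓ⌋₊ := Nat.floor_pos.2 ((one_le_div hℓ).2 hLn)
    exact main_estimate hL hm hc₀.le hθ'0 hθ'1 hC'0 Ψ hpos
      (h1.trans (ENNReal.ofReal_le_ofReal (le_max_left _ _)))
      (h2.trans (ENNReal.ofReal_le_ofReal (le_max_left _ _)))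
  -- shift `n + 1 ↦ N`
  rw [Filter.eventually_atTop] at hev ⊢
  obtain ⟨a, ha⟩ := hev
  refine ⟨a + 1, fun N hN => ?_⟩
  obtain ⟨n, rfl⟩ : ∃ n, N = n + 1 := Nat.exists_eq_succ_of_ne_zero (by omega)
  exact ha n (by omega)

end Summit.AtomisticToContinuum.BoseEinsteinCondensation.Theorems

end
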